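import Literature.AnabelianGeometry.EtaleTheta.Discharge.Sec5TransportAtBNOfBiKummerData
import Literature.AnabelianGeometry.EtaleTheta.Discharge.Sec5TransportsHYddOfConnectedTemperoidStrv
import Literature.AnabelianGeometry.EtaleTheta.Discharge.Sec5Lem59iiOfConnectedTemperoidData
import Literature.AnabelianGeometry.EtaleTheta.Discharge.Sec3Rmk372GenuineBase

/-!
# [EtTh] Thm. 5.6 (i), step T56-L09 («hBN»: `Ψ` carries the rigidity isomorphism at `B_N`) over the GENUINE base `B^temp(Π^tp_X)⁰` — the four FACT-row binders of `Thm56Sub.transportAtBN_of` DISCHARGED / PRODUCED (pp. 317, 328–331, 334 / PDF pp. 91, 102–105, 108)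

S. Mochizuki, *The étale theta function and its Frobenioid-theoretic manifestations*, Publ. RIMS **45** (2009)
[cite: MochizukiEtTh2009, Thm 5.6 p.328–329 (PDF pp.102–103); Thm 5.10 (ii) p.334 (PDF p.108); Prop 4.3 (iii) p.317 (PDF p.91); §5 p.331 (PDF p.105)].
PROOF-ONLY companion (no `def`, no instance, no new named fact; nothing landed is edited or restated).  abc-iut cell, block C (rung
LADDER-ABC:A2.C, R-C / K4 re-close), seat abc-iut-w6-d047 (gen 4), abc-iut-L2-lead R788/R807 menu row (M2): cone node **EtTh:Thm5.6(i)** —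
CONE-BOARD «RE-CLOSE (vacuous binder: F-0551, F-0552, F-0553, F-2768) · K4 class RECLOSABLE».  THE SITES (abc-iut-c312-2 CONE-FACT-SURGERY v4):
binders #13 `hcap : 𝔉.SgpCapSpec` (F-0552), #14 `hcup : 𝔉.SgpCupSpec` (F-0553), #15 `hdiff : 𝔉.BiKummerDifferenceMem` (F-0551), #19
`hstrv : 𝔉.StrvTransport Ψ α e θ` (F-2768) of abc-iut-w5-d020's `ThetaFrobenioid.Thm56Sub.transportAtBN_of` (T56-L09 «hBN»: at `B_N` a
self-equivalence `Ψ` carries `ρ_{B_N}(x)` to `ρ_{Ψ B_N}(aΨ x)`, proof of Thm. 5.6 p. 329); all four are `parametrised` predicates on the data-only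
interface `𝔉 : ThetaFrobenioid C D` (universal closures REFUTED) — consumed at NAMED INSTANCES.  The `Ψ := refl` route is NOT used.
* §1 `exists_shadow_unit_transports_hYdd_ofConnectedTemperoidData(_strv)` — abc-iut-w5-d245's transports capstone ([FrdI] Thm. 3.4 (iii)/(v),
  Prop. 5.6; [SemiAnbd] Prop. 3.2; Prop. 2.4) RE-RUN with the base-shadow law `hθ` and the Galois shadow `γ`, `hγ` EXPORTED next to the unit `e`,
  `D_c`, `D_p` and `hT ∧ hT′ ∧ hu ∧ hstrv ∧ hYdd` (the capstone hides `γ` under its `∃`; consumers stating T56-L09c / (C)-chain compatibilities AT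
  THE PRODUCED SHADOW need it); `_strv`: the section pair of `s^trv_N` (abc-iut-w5-d034) and «`D` of FSM-type / slim» (Rmk. 3.7.2 as printed at
  `B^temp(Π^tp_X)⁰`, abc-iut-f-138's `connectedPart_isOfFSMType` / `isSlim_connectedPart_bTemp`) discharged.
* §2 `transportAtBN_ofConnectedTemperoidData` — the site's SIBLING at abc-iut-w4-d099's `ofConnectedTemperoidData` with #13/#14 (+ `Epi`) and #15
  DISCHARGED (`sgpCapSpec_/sgpCupSpec_ofBiKummerData` inside w5-d020's `transportAtBN_ofBiKummerData`; abc-iut-w6-d054's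
  `biKummerDifferenceMem_ofConnectedTemperoidData` ⟸ the single printed input `hH` «`Π^tp_Ÿ ⊆ H_⊙`», §5 p. 322), `hσ` := the THEOREM
  `baseMap_strvOfBiKummerData`; residual FACT-row binder = #19 `hstrv` only.
* §3 `exists_transports_transportAtBN_ofConnectedTemperoidData` — END-KNIT for EVERY `Ψ` with `α, β` preserving `Div(s^⊓_N)`, `Div(s^⊔_N)`
  (Prop. 5.3 (vi)), given `h`, `hnd`, one non-group-like object, Prop. 2.4 and the `l·Δ_Θ` clause of Cor. 2.18 (i) as ∀γ inputs at the given
  `RigidData`: THERE EXIST `θA` (with `hθ`), `γ` (with `hγ`), a unit `e`, `D_c`, `D_p` realising the five transport binders, AND «hBN» holds for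
  them — `Ψ.mapAut_{B_N}(ρ_{B_N} x) = ρ_{Ψ B_N}(aΨ_{B_N} x)` — as soon as the Δ-transport `aΨ` read through the NORMALISING identification
  `β ≪≫ D_c⁻¹` is compatible with the produced `γ` (T56-L09c, the one θ-dependent T56 input, asked INSIDE the `∃` where `D_c`, `γ` are in scope).
  NO refuted-closure FACT row is a binder of §3: #19 PRODUCED, #13/#14/#15 discharged, `hP24`/`hΔL` are the printed Prop. 2.4 / Cor. 2.18 (i)
  clauses on the data (as the capstone states `hP24`), the rest is w5-d020's binder list verbatim (`P`-row laws, `hgeom`, `hconst`, `ρ` with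
  `hB`, `hK`, `hρ`, `hΨB` — Prop. 5.5 / abc-iut-L2-d4's Thm. 5.6 data).
HONEST FRAMING: kernel-checked implications between typed §5 data; nothing asserts that the §5 data exist for an actual curve; typed ≠ proved for
the named binders; no side taken on [IUTchIII] Cor. 3.12. [claim: MochizukiEtTh2009, status: refereed pre-IUT]
-/


noncomputable section

namespace Literature.AnabelianGeometry.EtaleTheta

open CategoryTheory Opposite FrobenioidCyclotomicRigidity Literature.AlgebraicGeometry.Frobenioids
  Literature.AnabelianGeometry.SemiGraphs Literature.AnabelianGeometry.SemiGraphs.GaloisObjects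

universe u₀ v₀ w

namespace ThetaFrobenioid

/-! ### §1. The transports capstone with the base shadow law and the Galois shadow EXPORTED -/

section Shadow

variable {K : Type u₀} [Field K] {X : SemiGraphs.TemperedArithmeticGroup.{u₀} K} {D₀ : Type u₀} [Category.{v₀} D₀]
  {V : FrdIMonoidStub.{w}} {T₀ : RealifiedDivisorMonoids (D₀ := D₀) V}
  {VD : FrdICatStub.{u₀ + 1, u₀, w} (ConnectedPart (BTemp X.Pi))}
  {tf : TemperedFrobenioid T₀ (ConnectedPart (BTemp X.Pi)) VD} {hZ : tf.monoidType = MonoidType.Z}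
  {hP : ∀ A : (ConnectedPart (BTemp X.Pi))ᵒᵖ, IsPerfect (tf.Φ.carrier A)}
  {NH : Subgroup (Field.absoluteGaloisGroup K) → tf.category → ℕ+ → Prop} {A₀ : tf.category}
  {hA₀ : PreFrobenioid.IsFrobeniusTrivial tf.toElem A₀} {hA₀' : SemiGraphs.IsGaloisObj A₀.base.obj}
  {lv N : ℕ+} {T : ThetaEnvData.{max u₀ w} N}
  {pullFrac : ∀ {A A' : (BiKummerSetting.mkOfConnectedTemperoid X tf hZ hP NH A₀ hA₀ hA₀').C} (_ : A' ⟶ A),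
    (BiKummerSetting.mkOfConnectedTemperoid X tf hZ hP NH A₀ hA₀ hA₀').biratUnits A → (BiKummerSetting.mkOfConnectedTemperoid X tf hZ hP NH A₀ hA₀ hA₀').biratUnits A'}
  {θ : (BiKummerSetting.mkOfConnectedTemperoid X tf hZ hP NH A₀ hA₀ hA₀').biratUnits
    (BiKummerSetting.mkOfConnectedTemperoid X tf hZ hP NH A₀ hA₀ hA₀').Aodot}
  {Bl : (BiKummerSetting.mkOfConnectedTemperoid X tf hZ hP NH A₀ hA₀ hA₀').C}
  {Pl : (BiKummerSetting.mkOfConnectedTemperoid X tf hZ hP NH A₀ hA₀ hA₀').FractionPair θ Bl}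
  {Rl : (BiKummerSetting.mkOfConnectedTemperoid X tf hZ hP NH A₀ hA₀ hA₀').NthRoot θ Pl lv pullFrac}
  (h : ModelFrobenioid.Hypotheses tf.divisorMonoid tf.ratFnFunctor)
  (Q : FrobenioidTheta.ThetaSubquotientStub.{w} (ConnectedPart (BTemp X.Pi))) (odd_l : Odd (lv : ℕ))
  (R : (BiKummerSetting.mkOfConnectedTemperoid X tf hZ hP NH A₀ hA₀ hA₀').NthRoot Rl.root Rl.pair N pullFrac)
  (ιX : T.PiX ≃ₜ* X.Pi) (K' : Type w) [Field K'] (constEmb : K'ˣ →* tf.biratUnitsModel R.BN)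
  (constEmb_injective : Function.Injective constEmb)
  (hinvc : ∀ g : Aut R.AN.base,
    pull tf.divisorMonoid g.hom (ModelFrobenioid.div R.pair.num) = ModelFrobenioid.div R.pair.num)
  (hinvp : ∀ y : T.PiX, y ∈ T.PiYdd →
    pull tf.divisorMonoid ((BiKummerSetting.mkOfConnectedTemperoid X tf hZ hP NH A₀ hA₀ hA₀').galoisSurj R.AN.base
      R.αData.isGalois (ιX y)).hom (ModelFrobenioid.div R.pair.den) = ModelFrobenioid.div R.pair.den)

/-- **Thm. 5.10 (ii) / Thm. 5.6–5.7 transport data at the genuine §5 data — abc-iut-w5-d245's capstone RE-RUN with the base shadow law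
and the GALOIS SHADOW EXPORTED.**  Same inputs as `exists_unit_transports_hYdd_ofConnectedTemperoidData` (model hypotheses `hD`, `hslim`,
`hnd`, `hN`; a section pair `(s^trv_N, φ)`; `Ψ, α, β`; Prop. 5.3 (vi) at `A_N`; Prop. 2.4); output: ONE base shadow `θA` WITH its law `hθ`
([FrdI] Thm. 3.4 (v): `Ψ` on `Aut_C(A_N)` lies over `θA`), ONE Galois shadow `γ` of `θA` WITH `hγ` ([SemiAnbd] Prop. 3.2, abc-iut-w5-d013's
`exists_galoisShadow_of_baseShadow`: `θ_B(ρ(y)) = ρ(γ y)` for the `B_N`-reading `θ_B := autBaseIsoAB⁻¹∘θA∘autBaseIsoAB`), ONE unit `e` and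
`D_c, D_p` with the five transport binders `hT ∧ hT′ ∧ hu ∧ hstrv ∧ hYdd`.  The exported `(hθ, γ, hγ)` are what a consumer needs to state
the T56-L09c / (C)-chain compatibilities AT THE PRODUCED SHADOW (the capstone hides them under its `∃`).
[cite: MochizukiEtTh2009, Thm 5.6 proof p.328–329 (PDF pp.102–103); Thm 5.10 (ii) p.334 (PDF p.108)] -/
theorem exists_shadow_unit_transports_hYdd_ofConnectedTemperoidData (hD : IsOfFSMType (ConnectedPart (BTemp X.Pi)))
    (hslim : IsSlim (ConnectedPart (BTemp X.Pi))) (hnd : IsNonDilatingOn tf.divisorMonoid)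
    (hN : ∃ A : (BiKummerSetting.mkOfConnectedTemperoid X tf hZ hP NH A₀ hA₀ hA₀').C,
      ¬ (PreFrobenioidData.ofModel tf.divisorMonoid tf.ratFnFunctor tf.divBNatTrans).IsGroupLikeObj A)
    (φ : ℕ+ →* End R.AN)
    (hφ : ∀ n : ℕ+, PreFrobenioid.degFr (BiKummerSetting.mkOfConnectedTemperoid X tf hZ hP NH A₀ hA₀ hA₀').F (End.asHom (φ n)) = n ∧
      PreFrobenioid.IsBaseIdentity (BiKummerSetting.mkOfConnectedTemperoid X tf hZ hP NH A₀ hA₀ hA₀').F (End.asHom (φ n)) ∧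
      PreFrobenioid.IsFrobeniusType (BiKummerSetting.mkOfConnectedTemperoid X tf hZ hP NH A₀ hA₀ hA₀').F (End.asHom (φ n)))
    (hc : ∀ (n : ℕ+) (g : Aut R.AN.base), (strvOfBiKummerData h R g).hom ≫ End.asHom (φ n) = End.asHom (φ n) ≫ (strvOfBiKummerData h R g).hom)
    (Ψ : (BiKummerSetting.mkOfConnectedTemperoid X tf hZ hP NH A₀ hA₀ hA₀').C ≌ (BiKummerSetting.mkOfConnectedTemperoid X tf hZ hP NH A₀ hA₀ hA₀').C)
    (α : Ψ.functor.obj (ofConnectedTemperoidData h Q odd_l R ιX K' constEmb constEmb_injective hinvc hinvp).AN ≅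
      (ofConnectedTemperoidData h Q odd_l R ιX K' constEmb constEmb_injective hinvc hinvp).AN)
    (β : Ψ.functor.obj (ofConnectedTemperoidData h Q odd_l R ιX K' constEmb constEmb_injective hinvc hinvp).BN ≅
      (ofConnectedTemperoidData h Q odd_l R ιX K' constEmb constEmb_injective hinvc hinvp).BN)
    (hdivcap₁ : (ofConnectedTemperoidData h Q odd_l R ιX K' constEmb constEmb_injective hinvc hinvp).pre.div
        (α.inv ≫ Ψ.functor.map (ofConnectedTemperoidData h Q odd_l R ιX K' constEmb constEmb_injective hinvc hinvp).sCap ≫ β.hom) =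
      (ofConnectedTemperoidData h Q odd_l R ιX K' constEmb constEmb_injective hinvc hinvp).pre.div
        (ofConnectedTemperoidData h Q odd_l R ιX K' constEmb constEmb_injective hinvc hinvp).sCap)
    (hdivcup₁ : (ofConnectedTemperoidData h Q odd_l R ιX K' constEmb constEmb_injective hinvc hinvp).pre.div
        (α.inv ≫ Ψ.functor.map (ofConnectedTemperoidData h Q odd_l R ιX K' constEmb constEmb_injective hinvc hinvp).sCup ≫ β.hom) =
      (ofConnectedTemperoidData h Q odd_l R ιX K' constEmb constEmb_injective hinvc hinvp).pre.div
        (ofConnectedTemperoidData h Q odd_l R ιX K' constEmb constEmb_injective hinvc hinvp).sCup)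
    (hP24 : ∀ γ : T.PiX ≃ₜ* T.PiX, T.PiYdd.map γ.toMulEquiv.toMonoidHom = T.PiYdd) :
    ∃ θA : Aut R.AN.base ≃* Aut R.AN.base,
      (∀ f : Aut R.AN, (PreFrobenioid.baseFunctor (BiKummerSetting.mkOfConnectedTemperoid X tf hZ hP NH A₀ hA₀ hA₀').F).mapIso
          (α.symm ≪≫ Ψ.functor.mapIso f ≪≫ α) =
        θA ((PreFrobenioid.baseFunctor (BiKummerSetting.mkOfConnectedTemperoid X tf hZ hP NH A₀ hA₀ hA₀').F).mapIso f)) ∧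
      ∃ γ : T.PiX ≃ₜ* T.PiX,
        (∀ y : T.PiX,
          (((ofConnectedTemperoidData h Q odd_l R ιX K' constEmb constEmb_injective hinvc hinvp).autBaseIsoAB.symm.trans
              θA).trans (ofConnectedTemperoidData h Q odd_l R ιX K' constEmb constEmb_injective hinvc hinvp).autBaseIsoAB)
            (rhoOfBiKummerData R ιX y) = rhoOfBiKummerData R ιX (γ y)) ∧
      ∃ e ∈ (ofConnectedTemperoidData h Q odd_l R ιX K' constEmb constEmb_injective hinvc hinvp).units
          (ofConnectedTemperoidData h Q odd_l R ιX K' constEmb constEmb_injective hinvc hinvp).AN,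
        ∃ Dc Dp : Aut (ofConnectedTemperoidData h Q odd_l R ιX K' constEmb constEmb_injective hinvc hinvp).BN,
          α.inv ≫ Ψ.functor.map (ofConnectedTemperoidData h Q odd_l R ιX K' constEmb constEmb_injective hinvc hinvp).sCap ≫
              (β ≪≫ Dc.symm).hom =
            e.hom ≫ (ofConnectedTemperoidData h Q odd_l R ιX K' constEmb constEmb_injective hinvc hinvp).sCap ≫
              (1 : Aut (ofConnectedTemperoidData h Q odd_l R ιX K' constEmb constEmb_injective hinvc hinvp).BN).hom ∧
          α.inv ≫ Ψ.functor.map (ofConnectedTemperoidData h Q odd_l R ιX K' constEmb constEmb_injective hinvc hinvp).sCup ≫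
              (β ≪≫ Dc.symm).hom =
            e.hom ≫ (ofConnectedTemperoidData h Q odd_l R ιX K' constEmb constEmb_injective hinvc hinvp).sCup ≫ Dp.hom ∧
          Dp ∈ (ofConnectedTemperoidData h Q odd_l R ιX K' constEmb constEmb_injective hinvc hinvp).units
            (ofConnectedTemperoidData h Q odd_l R ιX K' constEmb constEmb_injective hinvc hinvp).BN ∧
          (ofConnectedTemperoidData h Q odd_l R ιX K' constEmb constEmb_injective hinvc hinvp).StrvTransport Ψ α e
            (((ofConnectedTemperoidData h Q odd_l R ιX K' constEmb constEmb_injective hinvc hinvp).autBaseIsoAB.symm.trans θA).trans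
              (ofConnectedTemperoidData h Q odd_l R ιX K' constEmb constEmb_injective hinvc hinvp).autBaseIsoAB) ∧
          (ofConnectedTemperoidData h Q odd_l R ιX K' constEmb constEmb_injective hinvc hinvp).HB.map
              ((((ofConnectedTemperoidData h Q odd_l R ιX K' constEmb constEmb_injective hinvc hinvp).autBaseIsoAB.symm.trans
                  θA).trans
                (ofConnectedTemperoidData h Q odd_l R ιX K' constEmb constEmb_injective hinvc hinvp).autBaseIsoAB).toMonoidHom) =
            (ofConnectedTemperoidData h Q odd_l R ιX K' constEmb constEmb_injective hinvc hinvp).HB := by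
  -- the base shadow with its `Ψ^bs`, and the Frobenius transport of `Ψ` at `A_N` ([FrdI] Thm. 3.4 (iii)/(v))
  obtain ⟨Ψbs, hΨbs, eΨ, θA, ΨN, hθ, hdeg, hbi, hft⟩ :=
    exists_psiBaseTransportData_ofBiKummerData h R hD hslim hnd hN Ψ α
  -- "`Ψ` preserves base-equivalent pairs" ([FrdI] Thm. 3.4 (v), slim base)
  have hbe := baseEquivalent_map_of_model
    (𝔉 := ofConnectedTemperoidData h Q odd_l R ιX K' constEmb constEmb_injective hinvc hinvp) rfl h hD hslim hnd hN Ψ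
  -- `hT ∧ hT′ ∧ hu ∧ hstrv` with one unit (p427494) for the constructed section `s^trv_N` (a section: `baseMap_strvOfBiKummerData`)
  obtain ⟨e, he, Dc, Dp, hT, hT', hu, hstrv⟩ :=
    exists_unit_transports_ofBiKummerData h _ Q odd_l R ιX _ _ K' constEmb constEmb_injective _ _ hD Ψ hbe
      (baseMap_strvOfBiKummerData h R) φ hφ hc α β θA hθ ΨN hdeg hbi hft hdivcap₁ hdivcup₁
  -- `hYdd`: the shadow `γ` of `θA` ([SemiAnbd] Prop. 3.2, abc-iut-w5-d013) and Prop. 2.4 (p424854's reduction)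
  obtain ⟨γ, hγ⟩ := exists_galoisShadow_of_baseShadow h _ Q odd_l R ιX _ _ K' constEmb constEmb_injective _ _
    (fun _ hA => ⟨hA, fun _ => rfl⟩) (baseMap_strvOfBiKummerData h R) Ψ Ψbs eΨ α θA hθ
  have hYdd : (ofConnectedTemperoidData h Q odd_l R ιX K' constEmb constEmb_injective hinvc hinvp).HB.map
      ((((ofConnectedTemperoidData h Q odd_l R ιX K' constEmb constEmb_injective hinvc hinvp).autBaseIsoAB.symm.trans θA).trans
        (ofConnectedTemperoidData h Q odd_l R ιX K' constEmb constEmb_injective hinvc hinvp).autBaseIsoAB).toMonoidHom) =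
      (ofConnectedTemperoidData h Q odd_l R ιX K' constEmb constEmb_injective hinvc hinvp).HB :=
    hYdd_ofBiKummerData_of_prop24 h _ Q odd_l R ιX _ _ K' constEmb constEmb_injective _ _ _ γ (fun y => hγ y) (hP24 γ)
  exact ⟨θA, hθ, γ, hγ, e, he, Dc, Dp, hT, hT', hu, hstrv, hYdd⟩


/-- **The same with the σ-side and Rmk. 3.7.2 DISCHARGED**: the section pair of the constructed `s^trv_N` is abc-iut-w5-d034's
`exists_sectionPair_strvOfBiKummerData` ([FrdI] Prop. 5.6), and «`D` of FSM-type», «`D` slim» are THEOREMS at `D = B^temp(Π^tp_X)⁰`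
(`connectedPart_isOfFSMType`, `isSlim_connectedPart_bTemp` — [EtTh] Rmk. 3.7.2 as printed, abc-iut-f-138).  Inputs left: `h`, `hnd`, `hN`,
`Ψ, α, β`, Prop. 5.3 (vi), Prop. 2.4.  [cite: MochizukiEtTh2009, Thm 5.10 (ii) p.334 (PDF p.108); Rmk 3.7.2 p.306 (PDF p.80)] -/
theorem exists_shadow_unit_transports_hYdd_ofConnectedTemperoidData_strv (hnd : IsNonDilatingOn tf.divisorMonoid)
    (hN : ∃ A : (BiKummerSetting.mkOfConnectedTemperoid X tf hZ hP NH A₀ hA₀ hA₀').C,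
      ¬ (PreFrobenioidData.ofModel tf.divisorMonoid tf.ratFnFunctor tf.divBNatTrans).IsGroupLikeObj A)
    (Ψ : (BiKummerSetting.mkOfConnectedTemperoid X tf hZ hP NH A₀ hA₀ hA₀').C ≌ (BiKummerSetting.mkOfConnectedTemperoid X tf hZ hP NH A₀ hA₀ hA₀').C)
    (α : Ψ.functor.obj (ofConnectedTemperoidData h Q odd_l R ιX K' constEmb constEmb_injective hinvc hinvp).AN ≅
      (ofConnectedTemperoidData h Q odd_l R ιX K' constEmb constEmb_injective hinvc hinvp).AN)
    (β : Ψ.functor.obj (ofConnectedTemperoidData h Q odd_l R ιX K' constEmb constEmb_injective hinvc hinvp).BN ≅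
      (ofConnectedTemperoidData h Q odd_l R ιX K' constEmb constEmb_injective hinvc hinvp).BN)
    (hdivcap₁ : (ofConnectedTemperoidData h Q odd_l R ιX K' constEmb constEmb_injective hinvc hinvp).pre.div
        (α.inv ≫ Ψ.functor.map (ofConnectedTemperoidData h Q odd_l R ιX K' constEmb constEmb_injective hinvc hinvp).sCap ≫ β.hom) =
      (ofConnectedTemperoidData h Q odd_l R ιX K' constEmb constEmb_injective hinvc hinvp).pre.div
        (ofConnectedTemperoidData h Q odd_l R ιX K' constEmb constEmb_injective hinvc hinvp).sCap)
    (hdivcup₁ : (ofConnectedTemperoidData h Q odd_l R ιX K' constEmb constEmb_injective hinvc hinvp).pre.div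
        (α.inv ≫ Ψ.functor.map (ofConnectedTemperoidData h Q odd_l R ιX K' constEmb constEmb_injective hinvc hinvp).sCup ≫ β.hom) =
      (ofConnectedTemperoidData h Q odd_l R ιX K' constEmb constEmb_injective hinvc hinvp).pre.div
        (ofConnectedTemperoidData h Q odd_l R ιX K' constEmb constEmb_injective hinvc hinvp).sCup)
    (hP24 : ∀ γ : T.PiX ≃ₜ* T.PiX, T.PiYdd.map γ.toMulEquiv.toMonoidHom = T.PiYdd) :
    ∃ θA : Aut R.AN.base ≃* Aut R.AN.base,
      (∀ f : Aut R.AN, (PreFrobenioid.baseFunctor (BiKummerSetting.mkOfConnectedTemperoid X tf hZ hP NH A₀ hA₀ hA₀').F).mapIso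
          (α.symm ≪≫ Ψ.functor.mapIso f ≪≫ α) =
        θA ((PreFrobenioid.baseFunctor (BiKummerSetting.mkOfConnectedTemperoid X tf hZ hP NH A₀ hA₀ hA₀').F).mapIso f)) ∧
      ∃ γ : T.PiX ≃ₜ* T.PiX,
        (∀ y : T.PiX,
          (((ofConnectedTemperoidData h Q odd_l R ιX K' constEmb constEmb_injective hinvc hinvp).autBaseIsoAB.symm.trans
              θA).trans (ofConnectedTemperoidData h Q odd_l R ιX K' constEmb constEmb_injective hinvc hinvp).autBaseIsoAB)
            (rhoOfBiKummerData R ιX y) = rhoOfBiKummerData R ιX (γ y)) ∧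
      ∃ e ∈ (ofConnectedTemperoidData h Q odd_l R ιX K' constEmb constEmb_injective hinvc hinvp).units
          (ofConnectedTemperoidData h Q odd_l R ιX K' constEmb constEmb_injective hinvc hinvp).AN,
        ∃ Dc Dp : Aut (ofConnectedTemperoidData h Q odd_l R ιX K' constEmb constEmb_injective hinvc hinvp).BN,
          α.inv ≫ Ψ.functor.map (ofConnectedTemperoidData h Q odd_l R ιX K' constEmb constEmb_injective hinvc hinvp).sCap ≫
              (β ≪≫ Dc.symm).hom =
            e.hom ≫ (ofConnectedTemperoidData h Q odd_l R ιX K' constEmb constEmb_injective hinvc hinvp).sCap ≫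
              (1 : Aut (ofConnectedTemperoidData h Q odd_l R ιX K' constEmb constEmb_injective hinvc hinvp).BN).hom ∧
          α.inv ≫ Ψ.functor.map (ofConnectedTemperoidData h Q odd_l R ιX K' constEmb constEmb_injective hinvc hinvp).sCup ≫
              (β ≪≫ Dc.symm).hom =
            e.hom ≫ (ofConnectedTemperoidData h Q odd_l R ιX K' constEmb constEmb_injective hinvc hinvp).sCup ≫ Dp.hom ∧
          Dp ∈ (ofConnectedTemperoidData h Q odd_l R ιX K' constEmb constEmb_injective hinvc hinvp).units
            (ofConnectedTemperoidData h Q odd_l R ιX K' constEmb constEmb_injective hinvc hinvp).BN ∧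
          (ofConnectedTemperoidData h Q odd_l R ιX K' constEmb constEmb_injective hinvc hinvp).StrvTransport Ψ α e
            (((ofConnectedTemperoidData h Q odd_l R ιX K' constEmb constEmb_injective hinvc hinvp).autBaseIsoAB.symm.trans θA).trans
              (ofConnectedTemperoidData h Q odd_l R ιX K' constEmb constEmb_injective hinvc hinvp).autBaseIsoAB) ∧
          (ofConnectedTemperoidData h Q odd_l R ιX K' constEmb constEmb_injective hinvc hinvp).HB.map
              ((((ofConnectedTemperoidData h Q odd_l R ιX K' constEmb constEmb_injective hinvc hinvp).autBaseIsoAB.symm.trans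
                  θA).trans
                (ofConnectedTemperoidData h Q odd_l R ιX K' constEmb constEmb_injective hinvc hinvp).autBaseIsoAB).toMonoidHom) =
            (ofConnectedTemperoidData h Q odd_l R ιX K' constEmb constEmb_injective hinvc hinvp).HB := by
  obtain ⟨φ, hφ, hc⟩ := exists_sectionPair_strvOfBiKummerData (S := (BiKummerSetting.mkOfConnectedTemperoid X tf hZ hP NH A₀ hA₀ hA₀')) h R
  exact exists_shadow_unit_transports_hYdd_ofConnectedTemperoidData h Q odd_l R ιX K' constEmb constEmb_injective hinvc hinvp
    QuasiTemperoid.BTempConnected.connectedPart_isOfFSMType (isSlim_connectedPart_bTemp X.isTempered X.isSlimGroup) hnd hN φ hφ hc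
    Ψ α β hdivcap₁ hdivcup₁ hP24

end Shadow

/-! ### §2–§3. T56-L09 («hBN») over `B^temp(Π^tp_X)⁰`: the sibling with three FACT rows discharged, and the END-KNIT -/

section HBN

variable {K : Type u₀} [Field K] {X : SemiGraphs.TemperedArithmeticGroup.{u₀} K} {D₀ : Type u₀} [Category.{v₀} D₀]
  {V : FrdIMonoidStub.{w}} {T₀ : RealifiedDivisorMonoids (D₀ := D₀) V}
  {VD : FrdICatStub.{u₀ + 1, u₀, w} (ConnectedPart (BTemp X.Pi))}
  {tf : TemperedFrobenioid T₀ (ConnectedPart (BTemp X.Pi)) VD} {hZ : tf.monoidType = MonoidType.Z}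
  {hP : ∀ A : (ConnectedPart (BTemp X.Pi))ᵒᵖ, IsPerfect (tf.Φ.carrier A)}
  {NH : Subgroup (Field.absoluteGaloisGroup K) → tf.category → ℕ+ → Prop} {A₀ : tf.category}
  {hA₀ : PreFrobenioid.IsFrobeniusTrivial tf.toElem A₀} {hA₀' : SemiGraphs.IsGaloisObj A₀.base.obj}
  {lv N : ℕ+} {l' : ℕ} {RD : RigidData.{max u₀ w} N l'}
  {pullFrac : ∀ {A A' : (BiKummerSetting.mkOfConnectedTemperoid X tf hZ hP NH A₀ hA₀ hA₀').C} (_ : A' ⟶ A),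
    (BiKummerSetting.mkOfConnectedTemperoid X tf hZ hP NH A₀ hA₀ hA₀').biratUnits A → (BiKummerSetting.mkOfConnectedTemperoid X tf hZ hP NH A₀ hA₀ hA₀').biratUnits A'}
  {θ : (BiKummerSetting.mkOfConnectedTemperoid X tf hZ hP NH A₀ hA₀ hA₀').biratUnits
    (BiKummerSetting.mkOfConnectedTemperoid X tf hZ hP NH A₀ hA₀ hA₀').Aodot}
  {Bl : (BiKummerSetting.mkOfConnectedTemperoid X tf hZ hP NH A₀ hA₀ hA₀').C}
  {Pl : (BiKummerSetting.mkOfConnectedTemperoid X tf hZ hP NH A₀ hA₀ hA₀').FractionPair θ Bl}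
  {Rl : (BiKummerSetting.mkOfConnectedTemperoid X tf hZ hP NH A₀ hA₀ hA₀').NthRoot θ Pl lv pullFrac}
  (h : ModelFrobenioid.Hypotheses tf.divisorMonoid tf.ratFnFunctor)
  (Q : FrobenioidTheta.ThetaSubquotientStub.{w} (ConnectedPart (BTemp X.Pi))) (odd_l : Odd (lv : ℕ))
  (R : (BiKummerSetting.mkOfConnectedTemperoid X tf hZ hP NH A₀ hA₀ hA₀').NthRoot Rl.root Rl.pair N pullFrac)
  (ιX : RD.PiX ≃ₜ* X.Pi) (K' : Type w) [Field K'] (constEmb : K'ˣ →* tf.biratUnitsModel R.BN)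
  (constEmb_injective : Function.Injective constEmb)
  (hinvc : ∀ g : Aut R.AN.base,
    pull tf.divisorMonoid g.hom (ModelFrobenioid.div R.pair.num) = ModelFrobenioid.div R.pair.num)
  (hinvp : ∀ y : RD.PiX, y ∈ RD.PiYdd →
    pull tf.divisorMonoid ((BiKummerSetting.mkOfConnectedTemperoid X tf hZ hP NH A₀ hA₀ hA₀').galoisSurj R.AN.base
      R.αData.isGalois (ιX y)).hom (ModelFrobenioid.div R.pair.den) = ModelFrobenioid.div R.pair.den)

/-- **T56-L09 («hBN») over the GENUINE connected base `B^temp(Π^tp_X)⁰` with THREE of the four FACT-row binders of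
`Thm56Sub.transportAtBN_of` DISCHARGED**: #13 `hcap` (F-0552) / #14 `hcup` (F-0553) by the CLOSED producers and total epimorphicity
(inside abc-iut-w5-d020's `transportAtBN_ofBiKummerData`), #15 `hdiff` (F-0551 `BiKummerDifferenceMem`, Prop. 4.3 (iii)) by abc-iut-w6-d054's
`biKummerDifferenceMem_ofConnectedTemperoidData` from the single printed input `hH` («`Π^tp_Ÿ ⊆ H_⊙`», the §5 choice of `A_⊙`, p. 322), and the
section law `hσ` by the THEOREM `baseMap_strvOfBiKummerData` (`s^trv_N` CONSTRUCTED).  Residual FACT-row binder: #19 `hstrv` (F-2768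
`StrvTransport`, a `Ψ`-transport DATUM — PRODUCED for every `Ψ` in §3); everything else is abc-iut-w5-d020's binder list verbatim.
[cite: MochizukiEtTh2009, Thm 5.6 proof p.329 (PDF p.103)] -/
theorem transportAtBN_ofConnectedTemperoidData
    (hH : ∀ y : RD.PiX, y ∈ RD.PiYdd → ιX y ∈ (BiKummerSetting.mkOfConnectedTemperoid X tf hZ hP NH A₀ hA₀ hA₀').Hodot)
    (Ψ : (BiKummerSetting.mkOfConnectedTemperoid X tf hZ hP NH A₀ hA₀ hA₀').C ≌
      (BiKummerSetting.mkOfConnectedTemperoid X tf hZ hP NH A₀ hA₀ hA₀').C) (α : Ψ.functor.obj (ofConnectedTemperoidData h Q odd_l R ιX K' constEmb constEmb_injective hinvc hinvp).AN ≅ (ofConnectedTemperoidData h Q odd_l R ιX K' constEmb constEmb_injective hinvc hinvp).AN)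
    (β : Ψ.functor.obj (ofConnectedTemperoidData h Q odd_l R ιX K' constEmb constEmb_injective hinvc hinvp).BN ≅ (ofConnectedTemperoidData h Q odd_l R ιX K' constEmb constEmb_injective hinvc hinvp).BN)
    (eA : (ofConnectedTemperoidData h Q odd_l R ιX K' constEmb constEmb_injective hinvc hinvp).AN ≅ (ofConnectedTemperoidData h Q odd_l R ιX K' constEmb constEmb_injective hinvc hinvp).AN) (Dp : Aut (ofConnectedTemperoidData h Q odd_l R ιX K' constEmb constEmb_injective hinvc hinvp).BN)
    (θΨ : Aut R.BN.base ≃* Aut R.BN.base)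
    (hT : α.inv ≫ Ψ.functor.map (ofConnectedTemperoidData h Q odd_l R ιX K' constEmb constEmb_injective hinvc hinvp).sCap ≫ β.hom =
      eA.hom ≫ (ofConnectedTemperoidData h Q odd_l R ιX K' constEmb constEmb_injective hinvc hinvp).sCap ≫ (1 : Aut (ofConnectedTemperoidData h Q odd_l R ιX K' constEmb constEmb_injective hinvc hinvp).BN).hom)
    (hT' : α.inv ≫ Ψ.functor.map (ofConnectedTemperoidData h Q odd_l R ιX K' constEmb constEmb_injective hinvc hinvp).sCup ≫ β.hom =
      eA.hom ≫ (ofConnectedTemperoidData h Q odd_l R ιX K' constEmb constEmb_injective hinvc hinvp).sCup ≫ Dp.hom)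
    (hu : Dp ∈ (ofConnectedTemperoidData h Q odd_l R ιX K' constEmb constEmb_injective hinvc hinvp).units (ofConnectedTemperoidData h Q odd_l R ιX K' constEmb constEmb_injective hinvc hinvp).BN)
    (hstrv : (ofConnectedTemperoidData h Q odd_l R ιX K' constEmb constEmb_injective hinvc hinvp).StrvTransport Ψ α eA θΨ)
    (hYdd : (ofConnectedTemperoidData h Q odd_l R ιX K' constEmb constEmb_injective hinvc hinvp).HB.map θΨ.toMonoidHom = (ofConnectedTemperoidData h Q odd_l R ιX K' constEmb constEmb_injective hinvc hinvp).HB)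
    (P : ThetaSubquotientProj (ofConnectedTemperoidData h Q odd_l R ιX K' constEmb constEmb_injective hinvc hinvp))
    -- centrality of the geometric part (T56-L09b at the data)
    (hgeom : P.pre R.BN.base ≤ RD.aug.ker.map (rhoOfBiKummerData R ιX))
    (hconst : ∀ δ ∈ RD.aug.ker, ∀ τ : ModelFrobenioid.units R.BN, (tf.ratFnFunctor.map (rhoOfBiKummerData R ιX δ).hom.op).hom (ModelFrobenioid.unit τ.1.hom) =
        ModelFrobenioid.unit τ.1.hom)
    -- the row-2 laws of the subquotient datum and coverage (abc-iut-w5-d123 / abc-iut-w5-d013 shapes, verbatim)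
    (e : RD.mu → (ofConnectedTemperoidData h Q odd_l R ιX K' constEmb constEmb_injective hinvc hinvp).lDeltaModN (ofConnectedTemperoidData h Q odd_l R ιX K' constEmb constEmb_injective hinvc hinvp).BN)
    (he : Function.Surjective e)
    (hpre : ∀ k : RD.PiYdd, (k : RD.PiX) ∈ RD.lDeltaTheta → rhoOfBiKummerData R ιX k ∈ P.pre _)
    (hPproj : ∀ (k : RD.PiYdd) (hk : (k : RD.PiX) ∈ RD.lDeltaTheta) (hm : rhoOfBiKummerData R ιX k ∈ P.pre _),
      (QuotientGroup.mk (P.proj _ ⟨rhoOfBiKummerData R ιX k, hm⟩) : (ofConnectedTemperoidData h Q odd_l R ιX K' constEmb constEmb_injective hinvc hinvp).lDeltaModN (ofConnectedTemperoidData h Q odd_l R ιX K' constEmb constEmb_injective hinvc hinvp).BN) = e (RD.thetaMod ⟨k, hk⟩))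
    (hcov' : ∀ g ∈ P.pre ((ofConnectedTemperoidData h Q odd_l R ιX K' constEmb constEmb_injective hinvc hinvp).base.obj (ofConnectedTemperoidData h Q odd_l R ιX K' constEmb constEmb_injective hinvc hinvp).BN),
      ∃ k : RD.PiYdd, (k : RD.PiX) ∈ RD.lDeltaTheta ∧ rhoOfBiKummerData R ιX k = g)
    -- T56-L09c data (abc-iut-w5-d013): Ψ on (l·Δ_Θ) ⊗ ℤ/N and the printed relations
    (aΨ : ∀ A : (BiKummerSetting.mkOfConnectedTemperoid X tf hZ hP NH A₀ hA₀ hA₀').C, (ofConnectedTemperoidData h Q odd_l R ιX K' constEmb constEmb_injective hinvc hinvp).lDeltaModN A ≃* (ofConnectedTemperoidData h Q odd_l R ιX K' constEmb constEmb_injective hinvc hinvp).lDeltaModN (Ψ.functor.obj A))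
    (γ : RD.PiX ≃ₜ* RD.PiX)
    (hγ : ∀ y : RD.PiX, θΨ (rhoOfBiKummerData R ιX y) = rhoOfBiKummerData R ιX (γ y))
    (hγL : RD.lDeltaTheta.map γ.toMulEquiv.toMonoidHom = RD.lDeltaTheta)
    (haΨ : ∀ (k : RD.PiYdd) (hk : (k : RD.PiX) ∈ RD.lDeltaTheta) (hk' : γ k ∈ RD.lDeltaTheta),
      (ofConnectedTemperoidData h Q odd_l R ιX K' constEmb constEmb_injective hinvc hinvp).lDeltaModNMap β.hom (aΨ _ (e (RD.thetaMod ⟨k, hk⟩))) = e (RD.thetaMod ⟨γ k, hk'⟩))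
    -- the rigidity family with its Prop. 5.5 properties
    (ρ : RigidityFamily (ofConnectedTemperoidData h Q odd_l R ιX K' constEmb constEmb_injective hinvc hinvp))
    (hB : (ofConnectedTemperoidData h Q odd_l R ιX K' constEmb constEmb_injective hinvc hinvp).IsThetaSaturated (ofConnectedTemperoidData h Q odd_l R ιX K' constEmb constEmb_injective hinvc hinvp).BN)
    (hK : IsKummerDetermined (ofConnectedTemperoidData h Q odd_l R ιX K' constEmb constEmb_injective hinvc hinvp) P ρ hB) (hρ : IsFunctorialLinear (ofConnectedTemperoidData h Q odd_l R ιX K' constEmb constEmb_injective hinvc hinvp) ρ)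
    (hΨB : (ofConnectedTemperoidData h Q odd_l R ιX K' constEmb constEmb_injective hinvc hinvp).IsThetaSaturated (Ψ.functor.obj (ofConnectedTemperoidData h Q odd_l R ιX K' constEmb constEmb_injective hinvc hinvp).BN))
    (x : (ofConnectedTemperoidData h Q odd_l R ιX K' constEmb constEmb_injective hinvc hinvp).lDeltaModN (ofConnectedTemperoidData h Q odd_l R ιX K' constEmb constEmb_injective hinvc hinvp).BN) :
    (Ψ.functor.mapAut (ofConnectedTemperoidData h Q odd_l R ιX K' constEmb constEmb_injective hinvc hinvp).BN (ρ (ofConnectedTemperoidData h Q odd_l R ιX K' constEmb constEmb_injective hinvc hinvp).BN hB x : Aut (ofConnectedTemperoidData h Q odd_l R ιX K' constEmb constEmb_injective hinvc hinvp).BN) : Aut (Ψ.functor.obj (ofConnectedTemperoidData h Q odd_l R ιX K' constEmb constEmb_injective hinvc hinvp).BN)) =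
      ρ (Ψ.functor.obj (ofConnectedTemperoidData h Q odd_l R ιX K' constEmb constEmb_injective hinvc hinvp).BN) hΨB (aΨ (ofConnectedTemperoidData h Q odd_l R ιX K' constEmb constEmb_injective hinvc hinvp).BN x) :=
  transportAtBN_ofBiKummerData h _ Q odd_l R ιX _ _ K' constEmb constEmb_injective _ _ Ψ α β eA Dp θΨ
    (biKummerDifferenceMem_ofConnectedTemperoidData h Q odd_l R ιX K' constEmb constEmb_injective hinvc hinvp hH) hT hT' hu hstrv
    hYdd P (baseMap_strvOfBiKummerData h R) hgeom hconst e he hpre hPproj hcov' aΨ γ hγ hγL haΨ ρ hB hK hρ hΨB x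

/-- **T56-L09 («hBN») END-KNIT over `B^temp(Π^tp_X)⁰` for EVERY self-equivalence `Ψ` — all four FACT-row binders of
`Thm56Sub.transportAtBN_of` DISCHARGED (#13, #14, #15) or PRODUCED (#19 `hstrv`, together with the base shadow `θA`, its law `hθ`, the
Galois shadow `γ` with `hγ`, the unit `e`, `D_c`, `D_p`, `hT`, `hT′`, `hu`, `hYdd` — §1).**  The one θ-dependent T56 input — the
T56-L09c compatibility `haΨ` of the Δ-transport `aΨ`, read through the NORMALISING identification `β ≪≫ D_c⁻¹`, with the produced `γ` — is
asked INSIDE the existential, where `D_c` and `γ` are in scope; `hγL` is the `l·Δ_Θ` clause of Cor. 2.18 (i) at `γ` (input `hΔL`).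
[cite: MochizukiEtTh2009, Thm 5.6 proof p.328–329 (PDF pp.102–103); Thm 5.10 (ii) p.334 (PDF p.108)] -/
theorem exists_transports_transportAtBN_ofConnectedTemperoidData
    (hH : ∀ y : RD.PiX, y ∈ RD.PiYdd → ιX y ∈ (BiKummerSetting.mkOfConnectedTemperoid X tf hZ hP NH A₀ hA₀ hA₀').Hodot)
    (hnd : IsNonDilatingOn tf.divisorMonoid)
    (hN : ∃ A : (BiKummerSetting.mkOfConnectedTemperoid X tf hZ hP NH A₀ hA₀ hA₀').C,
      ¬ (PreFrobenioidData.ofModel tf.divisorMonoid tf.ratFnFunctor tf.divBNatTrans).IsGroupLikeObj A)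
    (Ψ : (BiKummerSetting.mkOfConnectedTemperoid X tf hZ hP NH A₀ hA₀ hA₀').C ≌ (BiKummerSetting.mkOfConnectedTemperoid X tf hZ hP NH A₀ hA₀ hA₀').C)
    (α : Ψ.functor.obj (ofConnectedTemperoidData h Q odd_l R ιX K' constEmb constEmb_injective hinvc hinvp).AN ≅
      (ofConnectedTemperoidData h Q odd_l R ιX K' constEmb constEmb_injective hinvc hinvp).AN)
    (β : Ψ.functor.obj (ofConnectedTemperoidData h Q odd_l R ιX K' constEmb constEmb_injective hinvc hinvp).BN ≅
      (ofConnectedTemperoidData h Q odd_l R ιX K' constEmb constEmb_injective hinvc hinvp).BN)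
    (hdivcap₁ : (ofConnectedTemperoidData h Q odd_l R ιX K' constEmb constEmb_injective hinvc hinvp).pre.div
        (α.inv ≫ Ψ.functor.map (ofConnectedTemperoidData h Q odd_l R ιX K' constEmb constEmb_injective hinvc hinvp).sCap ≫ β.hom) =
      (ofConnectedTemperoidData h Q odd_l R ιX K' constEmb constEmb_injective hinvc hinvp).pre.div
        (ofConnectedTemperoidData h Q odd_l R ιX K' constEmb constEmb_injective hinvc hinvp).sCap)
    (hdivcup₁ : (ofConnectedTemperoidData h Q odd_l R ιX K' constEmb constEmb_injective hinvc hinvp).pre.div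
        (α.inv ≫ Ψ.functor.map (ofConnectedTemperoidData h Q odd_l R ιX K' constEmb constEmb_injective hinvc hinvp).sCup ≫ β.hom) =
      (ofConnectedTemperoidData h Q odd_l R ιX K' constEmb constEmb_injective hinvc hinvp).pre.div
        (ofConnectedTemperoidData h Q odd_l R ιX K' constEmb constEmb_injective hinvc hinvp).sCup)
    -- [EtTh] Prop. 2.4 / Cor. 2.18 (i): `Π^tp_Ÿ` and `l·Δ_Θ` are stable under every topological automorphism of `Π^tp_X`
    (hP24 : ∀ γ : RD.PiX ≃ₜ* RD.PiX, RD.PiYdd.map γ.toMulEquiv.toMonoidHom = RD.PiYdd)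
    (hΔL : ∀ γ : RD.PiX ≃ₜ* RD.PiX, RD.lDeltaTheta.map γ.toMulEquiv.toMonoidHom = RD.lDeltaTheta)
    -- abc-iut-w5-d020's θ-independent binders of `transportAtBN_of`, verbatim
    (P : ThetaSubquotientProj (ofConnectedTemperoidData h Q odd_l R ιX K' constEmb constEmb_injective hinvc hinvp))
    (hgeom : P.pre R.BN.base ≤ RD.aug.ker.map (rhoOfBiKummerData R ιX))
    (hconst : ∀ δ ∈ RD.aug.ker, ∀ τ : ModelFrobenioid.units R.BN, (tf.ratFnFunctor.map (rhoOfBiKummerData R ιX δ).hom.op).hom (ModelFrobenioid.unit τ.1.hom) =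
        ModelFrobenioid.unit τ.1.hom)
    (e : RD.mu → (ofConnectedTemperoidData h Q odd_l R ιX K' constEmb constEmb_injective hinvc hinvp).lDeltaModN
      (ofConnectedTemperoidData h Q odd_l R ιX K' constEmb constEmb_injective hinvc hinvp).BN)
    (he : Function.Surjective e)
    (hpre : ∀ k : RD.PiYdd, (k : RD.PiX) ∈ RD.lDeltaTheta → rhoOfBiKummerData R ιX k ∈ P.pre _)
    (hPproj : ∀ (k : RD.PiYdd) (hk : (k : RD.PiX) ∈ RD.lDeltaTheta) (hm : rhoOfBiKummerData R ιX k ∈ P.pre _),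
      (QuotientGroup.mk (P.proj _ ⟨rhoOfBiKummerData R ιX k, hm⟩) : (ofConnectedTemperoidData h Q odd_l R ιX K' constEmb constEmb_injective hinvc hinvp).lDeltaModN
        (ofConnectedTemperoidData h Q odd_l R ιX K' constEmb constEmb_injective hinvc hinvp).BN) = e (RD.thetaMod ⟨k, hk⟩))
    (hcov' : ∀ g ∈ P.pre ((ofConnectedTemperoidData h Q odd_l R ιX K' constEmb constEmb_injective hinvc hinvp).base.obj
        (ofConnectedTemperoidData h Q odd_l R ιX K' constEmb constEmb_injective hinvc hinvp).BN),
      ∃ k : RD.PiYdd, (k : RD.PiX) ∈ RD.lDeltaTheta ∧ rhoOfBiKummerData R ιX k = g)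
    (aΨ : ∀ A : (BiKummerSetting.mkOfConnectedTemperoid X tf hZ hP NH A₀ hA₀ hA₀').C, (ofConnectedTemperoidData h Q odd_l R ιX K' constEmb constEmb_injective hinvc hinvp).lDeltaModN A ≃*
      (ofConnectedTemperoidData h Q odd_l R ιX K' constEmb constEmb_injective hinvc hinvp).lDeltaModN (Ψ.functor.obj A))
    (ρ : RigidityFamily (ofConnectedTemperoidData h Q odd_l R ιX K' constEmb constEmb_injective hinvc hinvp))
    (hB : (ofConnectedTemperoidData h Q odd_l R ιX K' constEmb constEmb_injective hinvc hinvp).IsThetaSaturated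
      (ofConnectedTemperoidData h Q odd_l R ιX K' constEmb constEmb_injective hinvc hinvp).BN)
    (hK : IsKummerDetermined (ofConnectedTemperoidData h Q odd_l R ιX K' constEmb constEmb_injective hinvc hinvp) P ρ hB)
    (hρ : IsFunctorialLinear (ofConnectedTemperoidData h Q odd_l R ιX K' constEmb constEmb_injective hinvc hinvp) ρ)
    (hΨB : (ofConnectedTemperoidData h Q odd_l R ιX K' constEmb constEmb_injective hinvc hinvp).IsThetaSaturated
      (Ψ.functor.obj (ofConnectedTemperoidData h Q odd_l R ιX K' constEmb constEmb_injective hinvc hinvp).BN)) :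
    ∃ θA : Aut R.AN.base ≃* Aut R.AN.base, (∀ f : Aut R.AN, (PreFrobenioid.baseFunctor (BiKummerSetting.mkOfConnectedTemperoid X tf hZ hP NH A₀ hA₀ hA₀').F).mapIso
          (α.symm ≪≫ Ψ.functor.mapIso f ≪≫ α) = θA ((PreFrobenioid.baseFunctor (BiKummerSetting.mkOfConnectedTemperoid X tf hZ hP NH A₀ hA₀ hA₀').F).mapIso f)) ∧
      ∃ γ : RD.PiX ≃ₜ* RD.PiX, (∀ y : RD.PiX,
          (((ofConnectedTemperoidData h Q odd_l R ιX K' constEmb constEmb_injective hinvc hinvp).autBaseIsoAB.symm.trans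
              θA).trans (ofConnectedTemperoidData h Q odd_l R ιX K' constEmb constEmb_injective hinvc hinvp).autBaseIsoAB)
            (rhoOfBiKummerData R ιX y) = rhoOfBiKummerData R ιX (γ y)) ∧
      ∃ eA ∈ (ofConnectedTemperoidData h Q odd_l R ιX K' constEmb constEmb_injective hinvc hinvp).units
          (ofConnectedTemperoidData h Q odd_l R ιX K' constEmb constEmb_injective hinvc hinvp).AN,
        ∃ Dc Dp : Aut (ofConnectedTemperoidData h Q odd_l R ιX K' constEmb constEmb_injective hinvc hinvp).BN,
          α.inv ≫ Ψ.functor.map (ofConnectedTemperoidData h Q odd_l R ιX K' constEmb constEmb_injective hinvc hinvp).sCap ≫ (β ≪≫ Dc.symm).hom =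
            eA.hom ≫ (ofConnectedTemperoidData h Q odd_l R ιX K' constEmb constEmb_injective hinvc hinvp).sCap ≫
              (1 : Aut (ofConnectedTemperoidData h Q odd_l R ιX K' constEmb constEmb_injective hinvc hinvp).BN).hom ∧
          α.inv ≫ Ψ.functor.map (ofConnectedTemperoidData h Q odd_l R ιX K' constEmb constEmb_injective hinvc hinvp).sCup ≫ (β ≪≫ Dc.symm).hom =
            eA.hom ≫ (ofConnectedTemperoidData h Q odd_l R ιX K' constEmb constEmb_injective hinvc hinvp).sCup ≫ Dp.hom ∧
          Dp ∈ (ofConnectedTemperoidData h Q odd_l R ιX K' constEmb constEmb_injective hinvc hinvp).units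
            (ofConnectedTemperoidData h Q odd_l R ιX K' constEmb constEmb_injective hinvc hinvp).BN ∧
          (ofConnectedTemperoidData h Q odd_l R ιX K' constEmb constEmb_injective hinvc hinvp).StrvTransport Ψ α eA
            (((ofConnectedTemperoidData h Q odd_l R ιX K' constEmb constEmb_injective hinvc hinvp).autBaseIsoAB.symm.trans θA).trans
              (ofConnectedTemperoidData h Q odd_l R ιX K' constEmb constEmb_injective hinvc hinvp).autBaseIsoAB) ∧
          (ofConnectedTemperoidData h Q odd_l R ιX K' constEmb constEmb_injective hinvc hinvp).HB.map
              ((((ofConnectedTemperoidData h Q odd_l R ιX K' constEmb constEmb_injective hinvc hinvp).autBaseIsoAB.symm.trans θA).trans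
                (ofConnectedTemperoidData h Q odd_l R ιX K' constEmb constEmb_injective hinvc hinvp).autBaseIsoAB).toMonoidHom) =
            (ofConnectedTemperoidData h Q odd_l R ιX K' constEmb constEmb_injective hinvc hinvp).HB ∧
          ((∀ (k : RD.PiYdd) (hk : (k : RD.PiX) ∈ RD.lDeltaTheta) (hk' : γ k ∈ RD.lDeltaTheta),
              (ofConnectedTemperoidData h Q odd_l R ιX K' constEmb constEmb_injective hinvc hinvp).lDeltaModNMap (β ≪≫ Dc.symm).hom
                  (aΨ _ (e (RD.thetaMod ⟨k, hk⟩))) = e (RD.thetaMod ⟨γ k, hk'⟩)) →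
            ∀ x : (ofConnectedTemperoidData h Q odd_l R ιX K' constEmb constEmb_injective hinvc hinvp).lDeltaModN
                (ofConnectedTemperoidData h Q odd_l R ιX K' constEmb constEmb_injective hinvc hinvp).BN,
              (Ψ.functor.mapAut (ofConnectedTemperoidData h Q odd_l R ιX K' constEmb constEmb_injective hinvc hinvp).BN
                  (ρ (ofConnectedTemperoidData h Q odd_l R ιX K' constEmb constEmb_injective hinvc hinvp).BN hB x :
                    Aut (ofConnectedTemperoidData h Q odd_l R ιX K' constEmb constEmb_injective hinvc hinvp).BN) :
                Aut (Ψ.functor.obj (ofConnectedTemperoidData h Q odd_l R ιX K' constEmb constEmb_injective hinvc hinvp).BN)) =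
              ρ (Ψ.functor.obj (ofConnectedTemperoidData h Q odd_l R ιX K' constEmb constEmb_injective hinvc hinvp).BN) hΨB
                (aΨ (ofConnectedTemperoidData h Q odd_l R ιX K' constEmb constEmb_injective hinvc hinvp).BN x)) := by
  obtain ⟨θA, hθ, γ, hγ, eA, heA, Dc, Dp, hT, hT', hu, hstrv, hYdd⟩ :=
    exists_shadow_unit_transports_hYdd_ofConnectedTemperoidData_strv h Q odd_l R ιX K' constEmb constEmb_injective hinvc hinvp hnd hN Ψ α β hdivcap₁ hdivcup₁ hP24
  refine ⟨θA, hθ, γ, hγ, eA, heA, Dc, Dp, hT, hT', hu, hstrv, hYdd, fun haΨ x => ?_⟩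
  exact transportAtBN_ofConnectedTemperoidData h Q odd_l R ιX K' constEmb constEmb_injective hinvc hinvp hH Ψ α (β ≪≫ Dc.symm) eA Dp
    _ hT hT' hu hstrv hYdd P hgeom hconst e he hpre hPproj hcov' aΨ γ hγ (hΔL γ) haΨ ρ hB hK hρ hΨB x

end HBN

end ThetaFrobenioid

end Literature.AnabelianGeometry.EtaleTheta

end
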